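import Literature.NumberTheory.Transcendental.GammaIsoTwistedTransfer
import Literature.NumberTheory.Transcendental.GammaIsoLogStep
import Literature.NumberTheory.Transcendental.GammaRelativeKummer
import HarnessLib

/-!
# Twisted Γ-isomorphisms: one-step extensions (algebraic elements, logarithms, Kummer levels)

Companion of `GammaIsoTwisted.lean` / `GammaIsoTwistedTransfer.lean` (twisted Γ-isomorphisms
`GammaField.IsGammaIsoTw σ c c'` over an isomorphism `σ` of base Γ-fields — the two-base form of
the tree's `GammaField.IsGammaIso` needed for Kirby 2010, Thm 2.1 =
`IsZilberField.eclIso_extension`). This file re-runs, over `σ`, the one-step extension lemmas of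
the proof of Bays–Kirby 2018, Prop. 11.2 (M. Bays, J. Kirby, *Pseudo-exponential maps, variants,
and quasiminimality*, Algebra & Number Theory 12 (2018), §3.3, §4.4, Lemma 8.3):

* `GammaField.aeval_lvGens_iff_of_ringHom` — the level-`M` transport of relations from any ring
  homomorphism extending `σ` and matching level generators (the common core of all converses);
* `GammaField.isGammaIsoTw_of_adjoinPtFieldHom` — **Kummer-generic tuples** (twisted form of
  `GammaField.isGammaIso_of_adjoinPtFieldHom`, Prop. 3.22 case (EXP)): a level-`0` embedding
  `K₁(α) → F` extending `σ` with `x ↦ x'`, `exp x ↦ exp x'` is a twisted Γ-isomorphism when the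
  `exp xᵢ` are Kummer-independent;
* `GammaField.IsGammaIsoTw.append_of_ringHom_adjoin` — twisted form of
  `IsGammaIso.append_of_ringHom_adjoin` (`GammaRelativeKummer.lean`): extending `c ↦ c'` by a
  Kummer-generic `b ↦ g` from an embedding of `⟨K₁ c⟩(b, exp b)`;
* the **algebraic step** (§4.4, Thm 4.17): `IsGammaIsoTw.aeval_sumElim_single_eq_zero_iff`,
  `IsGammaIsoTw.append_single_of_minpoly`, `IsGammaIsoTw.exists_append_single_of_mem_acl`;
* the **logarithmic step**: `IsGammaIsoTw.transport_eq_transport`,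
  `IsGammaIsoTw.aeval_lvGens_zero_append_single_iff`, `IsGammaIsoTw.append_single_of_indepModPowers`,
  `IsGammaIsoTw.exists_append_single_of_exp_mem_acl_of_indepModPowers`,
  `IsGammaIsoTw.exists_append_single_of_exp_mem_acl`.

All proofs are those of `GammaIsoAlgebraicStep.lean`, `GammaIsoLogStep.lean`,
`GammaKummerLevels.lean`, `GammaRelativeKummer.lean` with the base fixed by `σ` instead of
pointwise; the one-sided inputs (δ-bookkeeping, normalised bases, Kummer level extensions, point
embeddings) are used as they stand. Everything here is proved.

## References

* M. Bays, J. Kirby, *Pseudo-exponential maps, variants, and quasiminimality*, Algebra & Number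
  Theory 12 (2018) 493–549: Def. 3.19, Prop. 3.22, Lemma 4.8, §4.4 (Thm 4.17, proof),
  Lemma 8.3 (proof), Prop. 11.2.
* J. Kirby, *On quasiminimal excellent classes*, J. Symbolic Logic 75 (2010): Thm 2.1.
-/

noncomputable section

open Set MvPolynomial

universe u

namespace Literature.NumberTheory.Transcendental

namespace GammaField

open Literature.ModelTheory.ExponentialFields.ExponentialRing ZilberHomogeneity
open Literature.FieldTheory.Kummer

variable {F : Type u} [Field F] [CharZero F] [Literature.ModelTheory.ExponentialFields.ExponentialRing F]
variable {K₁ K₂ : Submodule ℚ F} {σ : fieldOf K₁ ≃+* fieldOf K₂} {N n : ℕ}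

/-! ### Level-`M` relations from a ring homomorphism extending `σ` -/

/-- **Level-`M` transport of relations from an embedding extending `σ`.** Let `Ω` be a field over
which `F` is an algebra, `ιK : K₁⁰ → Ω` lying over the inclusion `K₁⁰ ⊆ F`, and `gv` lying over
the level-`M` generators of `x`. If `ψ : Ω → F` is a ring homomorphism with `ψ ∘ ιK = σ` and
`ψ (gv s) = lvGens M x' s`, then a polynomial over `K₁⁰` vanishes at `lvGens M x` iff its
`σ`-transport vanishes at `lvGens M x'`. [folklore] -/
theorem aeval_lvGens_iff_of_ringHom {Ω : Type*} [Field Ω] [Algebra Ω F] {m : ℕ} {x x' : Fin m → F}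
    (M : ℕ) (ιK : fieldOf K₁ →+* Ω) (hιK : ∀ k : fieldOf K₁, algebraMap Ω F (ιK k) = k)
    (gv : Fin m ⊕ Fin m → Ω) (hgv : ∀ s, algebraMap Ω F (gv s) = lvGens M x s) (ψ : Ω →+* F)
    (hψK : ∀ k : fieldOf K₁, ψ (ιK k) = σ k) (hψv : ∀ s, ψ (gv s) = lvGens M x' s)
    (P : MvPolynomial (Fin m ⊕ Fin m) (fieldOf K₁)) :
    aeval (lvGens M x) P = 0 ↔
      aeval (lvGens M x') (MvPolynomial.map (σ : fieldOf K₁ →+* fieldOf K₂) P) = 0 := by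
  have h1 : algebraMap Ω F (eval₂ ιK gv P) = aeval (lvGens M x) P := by
    rw [eval₂_comp_left, aeval_def]
    congr 1
    · ext k; exact hιK k
    · funext s; exact hgv s
  have h2 : ψ (eval₂ ιK gv P) = aeval (lvGens M x') (MvPolynomial.map (σ : fieldOf K₁ →+* fieldOf K₂) P) := by
    rw [eval₂_comp_left, aeval_def, eval₂_map]
    congr 1
    · ext k; exact hψK k
    · funext s; exact hψv s
  rw [← h1, ← h2, map_eq_zero_iff _ (algebraMap Ω F).injective, map_eq_zero_iff ψ ψ.injective]

/-! ### Kummer-generic tuples: twisted Γ-isomorphisms from level-`0` embeddings -/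

section KummerLevels

variable {x x' : Fin N → F}

/-- **Twisted Γ-isomorphisms from level-`0` embeddings of Kummer-generic tuples** (twisted form
of `GammaField.isGammaIso_of_adjoinPtFieldHom`; Bays–Kirby 2018, Prop. 3.22, proof, case (EXP)).
Let `K₁` be Γ-closed in the algebraically closed `F`, and suppose the level-`0` field
`L₁ = K₁⁰(x, exp x)` admits a ring homomorphism `τ : L₁ → F` which is `σ` on `K₁⁰` with
`τ xᵢ = x'ᵢ`, `τ (exp xᵢ) = exp x'ᵢ`. If the `exp xᵢ` are independent modulo `n`-th powers in
`L₁` for every `n ≥ 1`, then `x ↦ x'` is a Γ-isomorphism over `σ`: at level `M`, `τ` extends to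
`L₁(exp (x/M!)) → F` with `exp (xᵢ/M!) ↦ exp (x'ᵢ/M!)` (`exists_ringHom_adjoin_roots`).
[cite: BaysKirby2018ANT, Prop. 3.22 (proof, case (EXP)), Def. 3.19] -/
theorem isGammaIsoTw_of_adjoinPtFieldHom [IsAlgClosed F] (hK : IsGammaClosed K₁)
    (τ : adjoinPtField K₁ x →+* F)
    (hτK : ∀ (z : F) (hz : z ∈ fieldOf K₁), τ ⟨z, mem_adjoinPtField_of_mem_fieldOf x hz⟩ = σ ⟨z, hz⟩)
    (hτx : ∀ i, τ ⟨x i, apply_mem_adjoinPtField x i⟩ = x' i)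
    (hτe : ∀ i, τ (expGen K₁ x i) = exp (x' i))
    (hind : ∀ n, 0 < n → IndepModPowers n (expGen K₁ x)) :
    IsGammaIsoTw σ x x' := by
  intro M
  set n := M.factorial with hn
  have hnpos : 0 < n := Nat.factorial_pos M
  set r : Fin N → F := fun i => exp (x i / (n : F)) with hr
  set r' : Fin N → F := fun i => exp (x' i / (n : F)) with hr'
  have hex := exists_ringHom_adjoin_roots hK τ hnpos (hind n hnpos) r r'
    (fun i => exp_div_factorial_pow (x i) M) (fun i => by rw [hτe]; exact exp_div_factorial_pow (x' i) M)
  set E := IntermediateField.adjoin (adjoinPtField K₁ x) (range r) with hE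
  obtain ⟨ψ, hψL, hψr⟩ := hex
  have hmem : ∀ j, lvGens M x j ∈ E := by
    rintro (i | i)
    · exact (IntermediateField.algebraMap_mem E ⟨x i, apply_mem_adjoinPtField x i⟩ : (x i) ∈ E)
    · exact IntermediateField.subset_adjoin _ _ (mem_range_self i)
  let g : Fin N ⊕ Fin N → E := fun j => ⟨lvGens M x j, hmem j⟩
  have hψg : ∀ j, ψ (g j) = lvGens M x' j := by
    rintro (i | i)
    · have : g (Sum.inl i) = algebraMap (adjoinPtField K₁ x) E ⟨x i, apply_mem_adjoinPtField x i⟩ := rfl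
      rw [this, hψL, hτx, lvGens_inl]
    · exact hψr i
  let ιK : fieldOf K₁ →+* E :=
    (algebraMap (adjoinPtField K₁ x) E).comp (algebraMap (fieldOf K₁) (adjoinPtField K₁ x))
  have hψK : ∀ k : fieldOf K₁, ψ (ιK k) = σ k := fun k => by
    show ψ (algebraMap (adjoinPtField K₁ x) E (algebraMap (fieldOf K₁) (adjoinPtField K₁ x) k)) = σ k
    rw [hψL]
    exact hτK k k.2
  exact aeval_lvGens_iff_of_ringHom M ιK (fun _ => rfl) g (fun _ => rfl) ψ hψK hψg

end KummerLevels

/-! ### Twisted Γ-isomorphisms from embeddings of `⟨K₁ c⟩(b, exp b)` (relative Kummer theory) -/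

section RelativeKummer

/-- **Twisted Γ-isomorphisms from embeddings of `⟨K₁ c⟩(b, exp b)`** (twisted form of
`IsGammaIso.append_of_ringHom_adjoin`; Bays–Kirby 2018, Prop. 3.22 / Def. 3.19). Let `K₁` be
Γ-closed in the algebraically closed `F`, `c ↦ c'` a Γ-isomorphism over `σ` with field
isomorphism `θ : ⟨K₁ c⟩ ≅ ⟨K₂ c'⟩`, and `τ : ⟨K₁ c⟩(b, exp b) → F` a ring homomorphism
extending `θ` with `bⱼ ↦ gⱼ`, `exp bⱼ ↦ exp gⱼ`. If `exp b₁, …, exp bₙ` are independent modulo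
`m`-th powers in `⟨K₁ c⟩(b, exp b)` for all `m ≥ 1`, then `(c, b) ↦ (c', g)` is a Γ-isomorphism
over `σ`. [cite: BaysKirby2018ANT, Prop. 3.22 (proof, case (EXP)), Def. 3.19, Lemma 8.3 (proof)] -/
theorem IsGammaIsoTw.append_of_ringHom_adjoin [IsAlgClosed F] (hK : IsGammaClosed K₁)
    {c c' : Fin N → F} (h : IsGammaIsoTw σ c c') {b g : Fin n → F}
    (τ : IntermediateField.adjoin (fieldOf K₁) (allGens c ∪ range (gammaPt b)) →+* F)
    (hτE : ∀ (z : F) (hz : z ∈ IntermediateField.adjoin (fieldOf K₁) (allGens c)),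
      τ ⟨z, adjoinField_le_adjoin_union c b hz⟩ = (h.fieldEquiv ⟨z, hz⟩ : F))
    (hτb : ∀ j, τ ⟨b j, IntermediateField.subset_adjoin _ _ (Or.inr ⟨Sum.inl j, rfl⟩)⟩ = g j)
    (hτe : ∀ j, τ ⟨exp (b j), IntermediateField.subset_adjoin _ _ (Or.inr ⟨Sum.inr j, rfl⟩)⟩ = exp (g j))
    (hind : ∀ m, 0 < m → IndepModPowers m (fun j =>
      (⟨exp (b j), IntermediateField.subset_adjoin _ _ (Or.inr ⟨Sum.inr j, rfl⟩)⟩ :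
        IntermediateField.adjoin (fieldOf K₁) (allGens c ∪ range (gammaPt b))))) :
    IsGammaIsoTw σ (Fin.append c b) (Fin.append c' g) := by
  classical
  intro M
  have hmpos : 0 < M.factorial := Nat.factorial_pos M
  have hroots : ∀ (m : ℕ), 0 < m → ∀ ζ : F, ζ ^ m = 1 →
      ζ ∈ IntermediateField.adjoin (fieldOf K₁) (allGens c ∪ range (gammaPt b)) :=
    fun m hm ζ hζ => adjoinField_le_adjoin_union c b (mem_adjoinField_allGens_of_pow_eq_one hK c hm hζ)
  obtain ⟨ψ, hψΩ, hψr⟩ := exists_ringHom_adjoin_roots_of_indepModPowers _ hroots τ hmpos _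
    (fun j h0 => exp_ne_zero (b j) (congrArg Subtype.val h0)) (hind _ hmpos)
    (fun j => exp (b j / (M.factorial : F))) (fun j => exp (g j / (M.factorial : F)))
    (fun j => exp_div_factorial_pow (b j) M)
    (fun j => by rw [hτe]; exact exp_div_factorial_pow (g j) M)
  have hmem : ∀ s, lvGens M (Fin.append c b) s ∈
      IntermediateField.adjoin (IntermediateField.adjoin (fieldOf K₁) (allGens c ∪ range (gammaPt b)))
        (range fun j : Fin n => exp (b j / (M.factorial : F))) := lvGens_append_mem_adjoin_roots (K := K₁) M c b
  have hΩmem : ∀ z : IntermediateField.adjoin (fieldOf K₁) (allGens c ∪ range (gammaPt b)), (z : F) ∈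
      IntermediateField.adjoin (IntermediateField.adjoin (fieldOf K₁) (allGens c ∪ range (gammaPt b)))
        (range fun j : Fin n => exp (b j / (M.factorial : F))) := fun z => IntermediateField.algebraMap_mem _ z
  have hψΩ' : ∀ z : IntermediateField.adjoin (fieldOf K₁) (allGens c ∪ range (gammaPt b)),
      ψ ⟨z, hΩmem z⟩ = τ z := fun z => hψΩ z
  have hψE : ∀ (z : F) (hz : z ∈ IntermediateField.adjoin (fieldOf K₁) (allGens c)),
      ψ ⟨z, hΩmem ⟨z, adjoinField_le_adjoin_union c b hz⟩⟩ = (h.fieldEquiv ⟨z, hz⟩ : F) := fun z hz => by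
    rw [hψΩ' ⟨z, adjoinField_le_adjoin_union c b hz⟩, hτE z hz]
  have hψval : ∀ s, ψ ⟨lvGens M (Fin.append c b) s, hmem s⟩ = lvGens M (Fin.append c' g) s := by
    rintro (s | s)
    · refine Fin.addCases (fun i => ?_) (fun j => ?_) s
      · have hci : c i ∈ IntermediateField.adjoin (fieldOf K₁) (allGens c) :=
          IntermediateField.subset_adjoin _ _ (mem_iUnion.2 ⟨0, Sum.inl i, rfl⟩)
        have e1 : (⟨lvGens M (Fin.append c b) (Sum.inl (Fin.castAdd n i)), hmem _⟩ :
            IntermediateField.adjoin (IntermediateField.adjoin (fieldOf K₁) (allGens c ∪ range (gammaPt b)))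
              (range fun j : Fin n => exp (b j / (M.factorial : F)))) =
            ⟨c i, hΩmem ⟨c i, adjoinField_le_adjoin_union c b hci⟩⟩ := Subtype.ext (by simp [lvGens])
        rw [e1, hψE (c i) hci, lvGens_inl, Fin.append_left]
        exact h.coe_fieldEquiv_apply i hci
      · have e1 : (⟨lvGens M (Fin.append c b) (Sum.inl (Fin.natAdd N j)), hmem _⟩ :
            IntermediateField.adjoin (IntermediateField.adjoin (fieldOf K₁) (allGens c ∪ range (gammaPt b)))
              (range fun j : Fin n => exp (b j / (M.factorial : F)))) =
            ⟨b j, hΩmem ⟨b j, IntermediateField.subset_adjoin _ _ (Or.inr ⟨Sum.inl j, rfl⟩)⟩⟩ :=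
          Subtype.ext (by simp [lvGens])
        rw [e1, hψΩ' ⟨b j, IntermediateField.subset_adjoin _ _ (Or.inr ⟨Sum.inl j, rfl⟩)⟩, hτb, lvGens_inl,
          Fin.append_right]
    · refine Fin.addCases (fun i => ?_) (fun j => ?_) s
      · have hci : exp (c i / (M.factorial : F)) ∈ IntermediateField.adjoin (fieldOf K₁) (allGens c) :=
          IntermediateField.subset_adjoin _ _ (mem_iUnion.2 ⟨M, Sum.inr i, rfl⟩)
        have e1 : (⟨lvGens M (Fin.append c b) (Sum.inr (Fin.castAdd n i)), hmem _⟩ :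
            IntermediateField.adjoin (IntermediateField.adjoin (fieldOf K₁) (allGens c ∪ range (gammaPt b)))
              (range fun j : Fin n => exp (b j / (M.factorial : F)))) =
            ⟨exp (c i / (M.factorial : F)), hΩmem ⟨_, adjoinField_le_adjoin_union c b hci⟩⟩ :=
          Subtype.ext (by simp [lvGens])
        rw [e1, hψE _ hci, lvGens_inr, Fin.append_left]
        exact h.coe_fieldEquiv_exp_div M i hci
      · have e1 : (⟨lvGens M (Fin.append c b) (Sum.inr (Fin.natAdd N j)), hmem _⟩ :
            IntermediateField.adjoin (IntermediateField.adjoin (fieldOf K₁) (allGens c ∪ range (gammaPt b)))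
              (range fun j : Fin n => exp (b j / (M.factorial : F)))) =
            ⟨exp (b j / (M.factorial : F)), IntermediateField.subset_adjoin _ _ (mem_range_self j)⟩ :=
          Subtype.ext (by simp [lvGens])
        rw [e1, hψr j, lvGens_inr, Fin.append_right]
  have hKmem : ∀ k : fieldOf K₁, (k : F) ∈ IntermediateField.adjoin (fieldOf K₁) (allGens c) := fun k =>
    IntermediateField.algebraMap_mem _ k
  let ιK : fieldOf K₁ →+* IntermediateField.adjoin
      (IntermediateField.adjoin (fieldOf K₁) (allGens c ∪ range (gammaPt b)))
      (range fun j : Fin n => exp (b j / (M.factorial : F))) :=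
    (algebraMap (IntermediateField.adjoin (fieldOf K₁) (allGens c ∪ range (gammaPt b))) _).comp
      (algebraMap (fieldOf K₁) (IntermediateField.adjoin (fieldOf K₁) (allGens c ∪ range (gammaPt b))))
  have hιK : ∀ k : fieldOf K₁, ιK k = ⟨k, hΩmem ⟨k, adjoinField_le_adjoin_union c b (hKmem k)⟩⟩ := fun k => rfl
  have hψK : ∀ k : fieldOf K₁, ψ (ιK k) = σ k := fun k => by
    rw [hιK, hψE (k : F) (hKmem k)]
    exact h.coe_fieldEquiv_algebraMap k
  let gv : Fin (N + n) ⊕ Fin (N + n) → IntermediateField.adjoin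
      (IntermediateField.adjoin (fieldOf K₁) (allGens c ∪ range (gammaPt b)))
      (range fun j : Fin n => exp (b j / (M.factorial : F))) := fun s => ⟨lvGens M (Fin.append c b) s, hmem s⟩
  exact aeval_lvGens_iff_of_ringHom M ιK (fun _ => rfl) gv (fun _ => rfl) ψ hψK hψval

end RelativeKummer

/-! ### The algebraic step over `σ` -/

section AlgebraicStep

variable {c c' : Fin N → F}

/-- **Same type at every level, over `σ`.** Let `θ : ⟨K₁ c⟩ ≅ ⟨K₂ c'⟩` be the field isomorphism
of a twisted Γ-isomorphism `c ↦ c'`, `x` integral over `⟨K₁ c⟩` with minimal polynomial `q`, and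
`x'` a root of `θ(q)`. Then for every level `M` and every polynomial `P` over `K₁⁰` in variables
for `x` and for `(c, exp (c/M!))`: `P(x, c, exp (c/M!)) = 0 ↔ P^σ(x', c', exp (c'/M!)) = 0`.
(Twisted form of `IsGammaIso.aeval_sumElim_single_eq_zero_iff`.)
[cite: BaysKirby2018ANT, §4.4 (Thm 4.17, proof)] -/
theorem IsGammaIsoTw.aeval_sumElim_single_eq_zero_iff (h : IsGammaIsoTw σ c c') {x x' : F}
    (hxi : IsIntegral (IntermediateField.adjoin (fieldOf K₁) (allGens c)) x)
    (hx' : Polynomial.eval₂ ((algebraMap (IntermediateField.adjoin (fieldOf K₂) (allGens c')) F).comp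
      h.fieldEquiv.toRingHom) x'
        (minpoly (IntermediateField.adjoin (fieldOf K₁) (allGens c)) x) = 0)
    (M : ℕ) (P : MvPolynomial (Fin 1 ⊕ (Fin N ⊕ Fin N)) (fieldOf K₁)) :
    aeval (Sum.elim ![x] (lvGens M c)) P = 0 ↔
      aeval (Sum.elim ![x'] (lvGens M c')) (MvPolynomial.map (σ : fieldOf K₁ →+* fieldOf K₂) P) = 0 := by
  classical
  set E := IntermediateField.adjoin (fieldOf K₁) (allGens c) with hE
  set E' := IntermediateField.adjoin (fieldOf K₂) (allGens c') with hE'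
  set θ : E ≃+* E' := h.fieldEquiv with hθ
  set q := minpoly E x with hq
  let v : Fin 1 ⊕ (Fin N ⊕ Fin N) → Polynomial E :=
    Sum.elim ![Polynomial.X] fun j => Polynomial.C ⟨lvGens M c j, lvGens_mem_adjoinField M c j⟩
  let v' : Fin 1 ⊕ (Fin N ⊕ Fin N) → Polynomial E' :=
    Sum.elim ![Polynomial.X] fun j => Polynomial.C ⟨lvGens M c' j, lvGens_mem_adjoinField M c' j⟩
  let Φ : MvPolynomial (Fin 1 ⊕ (Fin N ⊕ Fin N)) (fieldOf K₁) →ₐ[fieldOf K₁] Polynomial E := aeval v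
  let Φ' : MvPolynomial (Fin 1 ⊕ (Fin N ⊕ Fin N)) (fieldOf K₂) →ₐ[fieldOf K₂] Polynomial E' := aeval v'
  -- (α) evaluation compatibility
  have hα : ∀ P, ((Polynomial.aeval x (Φ P) : F)) = aeval (Sum.elim ![x] (lvGens M c)) P := by
    intro P
    have : ((Polynomial.aeval x).restrictScalars (fieldOf K₁)).comp Φ =
        aeval (Sum.elim ![x] (lvGens M c)) := by
      refine MvPolynomial.algHom_ext fun i => ?_
      rcases i with i | j
      · simp [Φ, v, Fin.fin_one_eq_zero i]
      · simp [Φ, v]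
    exact congrArg (fun f => f P) this
  have hα' : ∀ Q, ((Polynomial.aeval x' (Φ' Q) : F)) = aeval (Sum.elim ![x'] (lvGens M c')) Q := by
    intro Q
    have : ((Polynomial.aeval x').restrictScalars (fieldOf K₂)).comp Φ' =
        aeval (Sum.elim ![x'] (lvGens M c')) := by
      refine MvPolynomial.algHom_ext fun i => ?_
      rcases i with i | j
      · simp [Φ', v', Fin.fin_one_eq_zero i]
      · simp [Φ', v']
    exact congrArg (fun f => f Q) this
  -- (β) `θ(P̃) = (P^σ)̃`
  have hθK : ∀ k : fieldOf K₁, θ (algebraMap (fieldOf K₁) E k) = algebraMap (fieldOf K₂) E' (σ k) := by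
    intro k
    apply Subtype.ext
    exact h.coe_fieldEquiv_algebraMap k
  have hθg : ∀ j, θ ⟨lvGens M c j, lvGens_mem_adjoinField M c j⟩ =
      ⟨lvGens M c' j, lvGens_mem_adjoinField M c' j⟩ := by
    intro j
    apply Subtype.ext
    exact h.coe_fieldEquiv_lvGens M j
  have hβ : ∀ P, (Φ P).map θ.toRingHom = Φ' (MvPolynomial.map (σ : fieldOf K₁ →+* fieldOf K₂) P) := by
    intro P
    have : (Polynomial.mapRingHom θ.toRingHom).comp Φ.toRingHom =
        Φ'.toRingHom.comp (MvPolynomial.map (σ : fieldOf K₁ →+* fieldOf K₂)) := by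
      refine MvPolynomial.ringHom_ext (fun k => ?_) (fun i => ?_)
      · simp only [RingHom.comp_apply, AlgHom.toRingHom_eq_coe, RingHom.coe_coe, Polynomial.coe_mapRingHom,
          Φ, Φ', MvPolynomial.aeval_C, Polynomial.algebraMap_apply, Polynomial.map_C, MvPolynomial.map_C]
        congr 1
        exact hθK k
      · rcases i with i | j
        · simp [Φ, Φ', v, v', Fin.fin_one_eq_zero i]
        · simp only [RingHom.comp_apply, AlgHom.toRingHom_eq_coe, RingHom.coe_coe,
            Polynomial.coe_mapRingHom, Φ, Φ', v, v', aeval_X, Sum.elim_inr, Polynomial.map_C,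
            MvPolynomial.map_X]
          rw [show θ.toRingHom ⟨lvGens M c j, lvGens_mem_adjoinField M c j⟩ =
            ⟨lvGens M c' j, lvGens_mem_adjoinField M c' j⟩ from hθg j]
    exact congrArg (fun f => f P) this
  -- (γ) `θ(q)` is the minimal polynomial of `x'`
  have hqirr : Irreducible q := minpoly.irreducible hxi
  have hqm : q.Monic := minpoly.monic hxi
  have hγ : minpoly E' x' = q.map θ.toRingHom := by
    symm
    refine minpoly.eq_of_irreducible_of_monic ?_ ?_ (hqm.map _)
    · have : Polynomial.mapEquiv θ q = q.map θ.toRingHom := Polynomial.mapEquiv_apply θ q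
      rw [← this]
      exact (MulEquiv.irreducible_iff (Polynomial.mapEquiv θ)).2 hqirr
    · rw [Polynomial.aeval_def, Polynomial.eval₂_map]
      exact hx'
  -- (δ) the chain of equivalences
  rw [← hα P, ← hα' (MvPolynomial.map (σ : fieldOf K₁ →+* fieldOf K₂) P)]
  rw [show ((Polynomial.aeval x (Φ P) : F)) = 0 ↔ Polynomial.aeval x (Φ P) = 0 from Iff.rfl,
    show ((Polynomial.aeval x' (Φ' (MvPolynomial.map (σ : fieldOf K₁ →+* fieldOf K₂) P)) : F)) = 0 ↔
      Polynomial.aeval x' (Φ' (MvPolynomial.map (σ : fieldOf K₁ →+* fieldOf K₂) P)) = 0 from Iff.rfl,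
    ← minpoly.dvd_iff, ← minpoly.dvd_iff, hγ, ← hβ P, ← hq]
  rw [show q.map θ.toRingHom = Polynomial.mapEquiv θ q from (Polynomial.mapEquiv_apply θ q).symm,
    show (Φ P).map θ.toRingHom = Polynomial.mapEquiv θ (Φ P) from (Polynomial.mapEquiv_apply θ _).symm,
    map_dvd_iff]

/-- **The algebraic step over `σ`, relation form** (twisted form of
`IsGammaIso.append_single_of_minpoly`): with `θ`, `x` integral over `⟨K₁ c⟩` with `exp x`
transcendental over `⟨K₁ c⟩(x)`, and `x'` a root of `θ(minpoly x)` with `exp x'` transcendental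
over `⟨K₂ c'⟩(x')`, `(c, x) ↦ (c', x')` is a Γ-isomorphism over `σ`.
[cite: BaysKirby2018ANT, §4.4 (Thm 4.17, proof)] -/
theorem IsGammaIsoTw.append_single_of_minpoly {c c' : Fin N → F} (h : IsGammaIsoTw σ c c') {x x' : F}
    (hxi : IsIntegral (IntermediateField.adjoin (fieldOf K₁) (allGens c)) x)
    (hx' : Polynomial.eval₂ ((algebraMap (IntermediateField.adjoin (fieldOf K₂) (allGens c')) F).comp
      h.fieldEquiv.toRingHom) x'
        (minpoly (IntermediateField.adjoin (fieldOf K₁) (allGens c)) x) = 0)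
    (hex : exp x ∉ acl (insert x (gens (K₁ ⊔ Submodule.span ℚ (range c)))))
    (hex' : exp x' ∉ acl (insert x' (gens (K₂ ⊔ Submodule.span ℚ (range c'))))) :
    IsGammaIsoTw σ (Fin.append c ![x]) (Fin.append c' ![x']) := by
  intro M P
  have hp := algebraicIndependent_exp_div_factorial (K := K₁) (M := M) hex
  have hq := algebraicIndependent_exp_div_factorial (K := K₂) (M := M) hex'
  set ρ : Fin (N + 1) ⊕ Fin (N + 1) → Fin 1 ⊕ (Fin 1 ⊕ (Fin N ⊕ Fin N)) :=
    Sum.elim (Fin.addCases (fun i => Sum.inr (Sum.inr (Sum.inl i))) fun _ => Sum.inr (Sum.inl 0))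
      (Fin.addCases (fun i => Sum.inr (Sum.inr (Sum.inr i))) fun _ => Sum.inl 0) with hρ
  have e1 : aeval (lvGens M (Fin.append c ![x])) P =
      aeval (Sum.elim ![exp (x / (M.factorial : F))] (Sum.elim ![x] (lvGens M c))) (rename ρ P) := by
    rw [aeval_rename, ← lvGens_append_single_eq_comp]
  have e2 : aeval (lvGens M (Fin.append c' ![x'])) (MvPolynomial.map (σ : fieldOf K₁ →+* fieldOf K₂) P) =
      aeval (Sum.elim ![exp (x' / (M.factorial : F))] (Sum.elim ![x'] (lvGens M c')))
        (rename ρ (MvPolynomial.map (σ : fieldOf K₁ →+* fieldOf K₂) P)) := by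
    rw [aeval_rename, ← lvGens_append_single_eq_comp]
  rw [e1, e2, ← map_rename]
  exact aeval_sumElim_eq_zero_iff_map_of_forall _ (fun Q => h.aeval_sumElim_single_eq_zero_iff hxi hx' M Q)
    hp hq _

/-- **The algebraic step over `σ`** (twisted form of `IsGammaIso.exists_append_single_of_mem_acl`;
Bays–Kirby 2018, §4.4, proof of Thm 4.17, algebraic case). Let `F` be algebraically closed,
`c ↦ c'` a Γ-isomorphism over `σ` (an isomorphism of base Γ-fields) with `K₁ + ℚc ◁ F` and
`K₂ + ℚc' ◁ F`, and `x ∉ K₁ + ℚc` algebraic over the Γ-field `⟨K₁ c⟩`. Then there is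
`x' ∉ K₂ + ℚc'`, algebraic over `⟨K₂ c'⟩`, with `(c, x) ↦ (c', x')` a Γ-isomorphism over `σ`.
[cite: BaysKirby2018ANT, §4.4 (Thm 4.17, proof), Lemma 8.3 (proof)] -/
theorem IsGammaIsoTw.exists_append_single_of_mem_acl [IsAlgClosed F] {c c' : Fin N → F}
    (h : IsGammaIsoTw σ c c') (hσ : IsEBaseIso K₁ K₂ σ)
    (hs : IsStrong (K₁ ⊔ Submodule.span ℚ (range c)))
    (hs' : IsStrong (K₂ ⊔ Submodule.span ℚ (range c'))) {x : F}
    (hx : x ∈ acl (gens (K₁ ⊔ Submodule.span ℚ (range c)))) (hxX : x ∉ K₁ ⊔ Submodule.span ℚ (range c)) :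
    ∃ x' : F, x' ∈ acl (gens (K₂ ⊔ Submodule.span ℚ (range c'))) ∧
      x' ∉ K₂ ⊔ Submodule.span ℚ (range c') ∧
      IsGammaIsoTw σ (Fin.append c ![x]) (Fin.append c' ![x']) := by
  classical
  set E := IntermediateField.adjoin (fieldOf K₁) (allGens c) with hE
  set E' := IntermediateField.adjoin (fieldOf K₂) (allGens c') with hE'
  set θ : E ≃+* E' := h.fieldEquiv with hθ
  have hxi : IsIntegral E x := isIntegral_adjoinField_of_mem_acl hx
  set q := minpoly E x with hq
  set q' : Polynomial E' := q.map θ.toRingHom with hq'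
  have hqirr : Irreducible q := minpoly.irreducible hxi
  have hq'irr : Irreducible q' := by
    have : Polynomial.mapEquiv θ q = q' := Polynomial.mapEquiv_apply θ q
    rw [← this]
    exact (MulEquiv.irreducible_iff (Polynomial.mapEquiv θ)).2 hqirr
  have hdeg : (q'.map (algebraMap E' F)).degree ≠ 0 := by
    rw [Polynomial.degree_map]
    exact (Polynomial.degree_pos_of_irreducible hq'irr).ne'
  obtain ⟨x', hx'root⟩ := IsAlgClosed.exists_root _ hdeg
  have hx' : Polynomial.eval₂ ((algebraMap E' F).comp θ.toRingHom) x' q = 0 := by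
    rw [← Polynomial.eval₂_map, ← hq', ← Polynomial.eval_map]
    exact hx'root
  have hx'q' : Polynomial.aeval x' q' = 0 := by
    rw [Polynomial.aeval_def, hq', Polynomial.eval₂_map]; exact hx'
  have hx'alg : IsAlgebraic E' x' := ⟨q', hq'irr.ne_zero, hx'q'⟩
  have hx'acl : x' ∈ acl (gens (K₂ ⊔ Submodule.span ℚ (range c'))) := by
    rw [← acl_coe_adjoinField_eq K₂ c']
    exact mem_acl_coe_of_isAlgebraic E' hx'alg
  have hx'X : x' ∉ K₂ ⊔ Submodule.span ℚ (range c') := by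
    intro hx'X
    have hx'E : x' ∈ E' := mem_adjoinField_of_mem_sup hx'X
    have hroot : q'.IsRoot ⟨x', hx'E⟩ := by
      have h1 : algebraMap E' F (Polynomial.aeval (⟨x', hx'E⟩ : E') q') = 0 := by
        rw [← Polynomial.aeval_algebraMap_apply F (⟨x', hx'E⟩ : E') q']; exact hx'q'
      have h2 : Polynomial.aeval (⟨x', hx'E⟩ : E') q' = 0 :=
        (algebraMap E' F).injective (by rw [h1, map_zero])
      rwa [Polynomial.coe_aeval_eq_eval] at h2
    have hdeg1 : q'.degree = 1 := Polynomial.degree_eq_one_of_irreducible_of_root hq'irr hroot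
    have hdegq : q.degree = 1 := by
      rw [hq', Polynomial.degree_map] at hdeg1; exact hdeg1
    obtain ⟨e, he⟩ := minpoly.mem_range_of_degree_eq_one E x hdegq
    have hxe : x = (e : F) := he.symm
    have hqe : q = Polynomial.X - Polynomial.C e := by
      rw [hq, hxe]; exact minpoly.eq_X_sub_C (B := F) e
    have hx'e : x' = (θ e : F) := by
      have := hx'q'
      rw [hq', hqe, Polynomial.map_sub, Polynomial.map_X, Polynomial.map_C, map_sub, Polynomial.aeval_X,
        Polynomial.aeval_C, sub_eq_zero] at this
      exact this
    have hback : (h.fieldEquiv.symm ⟨x', hx'E⟩ : F) ∈ K₁ ⊔ Submodule.span ℚ (range c) := by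
      rw [h.coe_fieldEquiv_symm_eq, h.symm.coe_fieldEquiv_eq_transport hx'X]
      exact h.symm.transport_mem hσ.symm hx'X
    have hsymm : h.fieldEquiv.symm ⟨x', hx'E⟩ = e := by
      apply h.fieldEquiv.injective
      rw [RingEquiv.apply_symm_apply]
      exact Subtype.ext hx'e
    rw [hsymm, ← hxe] at hback
    exact hxX hback
  refine ⟨x', hx'acl, hx'X, h.append_single_of_minpoly hxi hx' ?_ ?_⟩
  · exact exp_not_mem_acl_of_mem_acl hs hx hxX
  · exact exp_not_mem_acl_of_mem_acl hs' hx'acl hx'X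

end AlgebraicStep

/-! ### The logarithmic step over `σ` -/

section LogStep

/-- **Twisted Γ-isomorphisms agreeing on generators have the same transport** (twisted form of
`IsGammaIso.transport_eq_transport`): if `x ↦ x'` and `y ↦ y'` are Γ-isomorphisms over the same
`σ`, the `xᵢ` lie in `K₁ + ℚy` and the transport of `y ↦ y'` sends `xᵢ ↦ x'ᵢ`, then both
transports agree on `K₁ + ℚx`. [folklore] -/
theorem IsGammaIsoTw.transport_eq_transport {n m : ℕ} {x x' : Fin n → F} {y y' : Fin m → F}
    (h₁ : IsGammaIsoTw σ x x') (h₂ : IsGammaIsoTw σ y y')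
    (hxy : ∀ i, x i ∈ K₁ ⊔ Submodule.span ℚ (range y)) (heq : ∀ i, h₂.transport (x i) = x' i)
    {z : F} (hz : z ∈ K₁ ⊔ Submodule.span ℚ (range x)) : h₁.transport z = h₂.transport z := by
  classical
  obtain ⟨κ, hκ, w, hw, rfl⟩ := Submodule.mem_sup.1 hz
  obtain ⟨q, rfl⟩ := (Submodule.mem_span_range_iff_exists_fun ℚ).1 hw
  rw [h₁.transport_add_sum_smul hκ q]
  have hsum : (∑ i, q i • x i) ∈ K₁ ⊔ Submodule.span ℚ (range y) :=
    Submodule.sum_mem _ fun i _ => Submodule.smul_mem _ _ (hxy i)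
  rw [h₂.transport_add (Submodule.mem_sup_left hκ) hsum, h₂.transport_of_mem hκ]
  congr 1
  induction (Finset.univ : Finset (Fin n)) using Finset.induction_on with
  | empty =>
    rw [Finset.sum_empty, Finset.sum_empty, h₂.transport_of_mem K₁.zero_mem]
    have : (⟨(0 : F), mem_fieldOf_of_mem K₁.zero_mem⟩ : fieldOf K₁) = 0 := Subtype.ext rfl
    rw [this, map_zero]; rfl
  | insert i s hi ih =>
    rw [Finset.sum_insert hi, Finset.sum_insert hi,
      h₂.transport_add (Submodule.smul_mem _ _ (hxy i))
        (Submodule.sum_mem _ fun j _ => Submodule.smul_mem _ _ (hxy j)),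
      h₂.transport_smul _ (hxy i), heq i, ih]

/-- **Level-`0` relations of `(c, d)` and `(c', d')` correspond over `σ`** (twisted form of
`IsGammaIso.ker_aeval_lvGens_zero_append_single_eq`): `exp d` integral over `⟨K₁ c⟩`, `exp d'`
a root of `θ(minpoly (exp d))`, `d`, `d'` transcendental over `K₁⁰[c, exp c, exp d]`,
`K₂⁰[c', exp c', exp d']`. [cite: BaysKirby2018ANT, §4.4 (Thm 4.17, proof)] -/
theorem IsGammaIsoTw.aeval_lvGens_zero_append_single_iff {c c' : Fin N → F} (h : IsGammaIsoTw σ c c')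
    {d d' : F} (hyi : IsIntegral (IntermediateField.adjoin (fieldOf K₁) (allGens c)) (exp d))
    (hY : Polynomial.eval₂ ((algebraMap (IntermediateField.adjoin (fieldOf K₂) (allGens c')) F).comp
      h.fieldEquiv.toRingHom) (exp d')
        (minpoly (IntermediateField.adjoin (fieldOf K₁) (allGens c)) (exp d)) = 0)
    (hd : d ∉ acl (insert (exp d) (gens (K₁ ⊔ Submodule.span ℚ (range c)))))
    (hd' : d' ∉ acl (insert (exp d') (gens (K₂ ⊔ Submodule.span ℚ (range c')))))
    (P : MvPolynomial (Fin (N + 1) ⊕ Fin (N + 1)) (fieldOf K₁)) :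
    aeval (lvGens 0 (Fin.append c ![d])) P = 0 ↔
      aeval (lvGens 0 (Fin.append c' ![d'])) (MvPolynomial.map (σ : fieldOf K₁ →+* fieldOf K₂) P) = 0 := by
  have hp := algebraicIndependent_single_of_not_mem_acl (K := K₁) hd
  have hq := algebraicIndependent_single_of_not_mem_acl (K := K₂) hd'
  set ρ : Fin (N + 1) ⊕ Fin (N + 1) → Fin 1 ⊕ (Fin 1 ⊕ (Fin N ⊕ Fin N)) :=
    Sum.elim (Fin.addCases (fun i => Sum.inr (Sum.inr (Sum.inl i))) fun _ => Sum.inl 0)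
      (Fin.addCases (fun i => Sum.inr (Sum.inr (Sum.inr i))) fun _ => Sum.inr (Sum.inl 0)) with hρ
  have e1 : aeval (lvGens 0 (Fin.append c ![d])) P =
      aeval (Sum.elim ![d] (Sum.elim ![exp d] (lvGens 0 c))) (rename ρ P) := by
    rw [aeval_rename, ← lvGens_zero_append_single_eq_comp]
  have e2 : aeval (lvGens 0 (Fin.append c' ![d'])) (MvPolynomial.map (σ : fieldOf K₁ →+* fieldOf K₂) P) =
      aeval (Sum.elim ![d'] (Sum.elim ![exp d'] (lvGens 0 c')))
        (rename ρ (MvPolynomial.map (σ : fieldOf K₁ →+* fieldOf K₂) P)) := by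
    rw [aeval_rename, ← lvGens_zero_append_single_eq_comp]
  rw [e1, e2, ← map_rename]
  exact aeval_sumElim_eq_zero_iff_map_of_forall _
    (fun Q => h.aeval_sumElim_single_eq_zero_iff hyi hY 0 Q) hp hq _

/-- **The logarithmic step over `σ` for a Kummer-normalised tuple** (twisted form of
`IsGammaIso.append_single_of_indepModPowers`): in the situation of
`aeval_lvGens_zero_append_single_iff`, if `K₁` is Γ-closed in the algebraically closed `F` and the
exponentials of `(c, d)` are Kummer-independent in `K₁⁰(c, d, exp c, exp d)`, then
`(c, d) ↦ (c', d')` is a Γ-isomorphism over `σ`.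
[cite: BaysKirby2018ANT, Prop. 3.22, §4.4 (Thm 4.17, proof)] -/
theorem IsGammaIsoTw.append_single_of_indepModPowers [IsAlgClosed F] (hK : IsGammaClosed K₁)
    {c c' : Fin N → F} (h : IsGammaIsoTw σ c c') {d d' : F}
    (hyi : IsIntegral (IntermediateField.adjoin (fieldOf K₁) (allGens c)) (exp d))
    (hY : Polynomial.eval₂ ((algebraMap (IntermediateField.adjoin (fieldOf K₂) (allGens c')) F).comp
      h.fieldEquiv.toRingHom) (exp d')
        (minpoly (IntermediateField.adjoin (fieldOf K₁) (allGens c)) (exp d)) = 0)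
    (hd : d ∉ acl (insert (exp d) (gens (K₁ ⊔ Submodule.span ℚ (range c)))))
    (hd' : d' ∉ acl (insert (exp d') (gens (K₂ ⊔ Submodule.span ℚ (range c')))))
    (hind : ∀ m, 0 < m → IndepModPowers m (expGen K₁ (Fin.append c ![d]))) :
    IsGammaIsoTw σ (Fin.append c ![d]) (Fin.append c' ![d']) := by
  set x := Fin.append c ![d] with hx
  set x' := Fin.append c' ![d'] with hx'
  have hiff : ∀ p : MvPolynomial (Fin (N + 1) ⊕ Fin (N + 1)) (fieldOf K₁),
      aeval (lvGens 0 x) p = 0 ↔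
        eval₂ ((algebraMap (fieldOf K₂) F).comp (σ : fieldOf K₁ →+* fieldOf K₂)) (lvGens 0 x') p = 0 := by
    intro p
    rw [h.aeval_lvGens_zero_append_single_iff hyi hY hd hd' p, aeval_def, eval₂_map]
  let τ : adjoinPtField K₁ x →+* F :=
    pointFieldHom ((algebraMap (fieldOf K₂) F).comp (σ : fieldOf K₁ →+* fieldOf K₂)) (lvGens 0 x)
      (lvGens 0 x') hiff
  refine isGammaIsoTw_of_adjoinPtFieldHom hK τ (fun z hz => ?_) (fun i => ?_) (fun i => ?_) hind
  · have := pointFieldHom_algebraMap ((algebraMap (fieldOf K₂) F).comp (σ : fieldOf K₁ →+* fieldOf K₂))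
      (lvGens 0 x) (lvGens 0 x') hiff ⟨z, hz⟩
    exact this
  · have := pointFieldHom_apply_self ((algebraMap (fieldOf K₂) F).comp (σ : fieldOf K₁ →+* fieldOf K₂))
      (lvGens 0 x) (lvGens 0 x') hiff (Sum.inl i)
    simpa only [lvGens_inl] using this
  · have := pointFieldHom_apply_self ((algebraMap (fieldOf K₂) F).comp (σ : fieldOf K₁ →+* fieldOf K₂))
      (lvGens 0 x) (lvGens 0 x') hiff (Sum.inr i)
    have e1 : expGen K₁ x i = ⟨lvGens 0 x (Sum.inr i),
        IntermediateField.subset_adjoin _ _ (mem_range_self (Sum.inr i))⟩ :=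
      Subtype.ext (by rw [coe_expGen]; exact (lvGens_zero_inr x i).symm)
    rw [e1, this, lvGens_zero_inr]

/-- **The logarithmic step over `σ` for a Kummer-normalised tuple, existence** (twisted form of
`IsGammaIso.exists_append_single_of_exp_mem_acl_of_indepModPowers`). Let `K₁` be Γ-closed in
the algebraically closed `F` with `exp` onto `Fˣ`, `c ↦ c'` a Γ-isomorphism over `σ` (an
isomorphism of base Γ-fields) with `K₁ + ℚc ◁ F`, `K₂ + ℚc' ◁ F`, and `d ∉ K₁ + ℚc` with `exp d`
algebraic over `⟨K₁ c⟩` and `(c, d)` Kummer-normalised. Then there is `d' ∉ K₂ + ℚc'` with `exp d'`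
algebraic over `⟨K₂ c'⟩` and `(c, d) ↦ (c', d')` a Γ-isomorphism over `σ`.
[cite: BaysKirby2018ANT, §4.4 (Thm 4.17, proof), Lemma 8.3 (proof)] -/
theorem IsGammaIsoTw.exists_append_single_of_exp_mem_acl_of_indepModPowers [IsAlgClosed F]
    (hK : IsGammaClosed K₁) (hsurj : IsSurjectiveOntoUnits F) {c c' : Fin N → F}
    (h : IsGammaIsoTw σ c c') (hσ : IsEBaseIso K₁ K₂ σ)
    (hs : IsStrong (K₁ ⊔ Submodule.span ℚ (range c)))
    (hs' : IsStrong (K₂ ⊔ Submodule.span ℚ (range c'))) {d : F}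
    (hdacl : exp d ∈ acl (gens (K₁ ⊔ Submodule.span ℚ (range c))))
    (hdX : d ∉ K₁ ⊔ Submodule.span ℚ (range c))
    (hind : ∀ m, 0 < m → IndepModPowers m (expGen K₁ (Fin.append c ![d]))) :
    ∃ d' : F, exp d' ∈ acl (gens (K₂ ⊔ Submodule.span ℚ (range c'))) ∧
      d' ∉ K₂ ⊔ Submodule.span ℚ (range c') ∧
      IsGammaIsoTw σ (Fin.append c ![d]) (Fin.append c' ![d']) := by
  classical
  set E := IntermediateField.adjoin (fieldOf K₁) (allGens c) with hE
  set E' := IntermediateField.adjoin (fieldOf K₂) (allGens c') with hE'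
  set θ : E ≃+* E' := h.fieldEquiv with hθ
  set y := exp d with hy
  have hyi : IsIntegral E y := isIntegral_adjoinField_of_mem_acl hdacl
  set g := minpoly E y with hg
  set g' : Polynomial E' := g.map θ.toRingHom with hg'
  have hgirr : Irreducible g := minpoly.irreducible hyi
  have hg'irr : Irreducible g' := by
    have : Polynomial.mapEquiv θ g = g' := Polynomial.mapEquiv_apply θ g
    rw [← this]
    exact (MulEquiv.irreducible_iff (Polynomial.mapEquiv θ)).2 hgirr
  have hdeg : (g'.map (algebraMap E' F)).degree ≠ 0 := by
    rw [Polynomial.degree_map]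
    exact (Polynomial.degree_pos_of_irreducible hg'irr).ne'
  obtain ⟨Y, hYroot⟩ := IsAlgClosed.exists_root _ hdeg
  have hY : Polynomial.eval₂ ((algebraMap E' F).comp θ.toRingHom) Y g = 0 := by
    rw [← Polynomial.eval₂_map, ← hg', ← Polynomial.eval_map]
    exact hYroot
  have hYg' : Polynomial.aeval Y g' = 0 := by
    rw [Polynomial.aeval_def, hg', Polynomial.eval₂_map]; exact hY
  have hY0 : Y ≠ 0 := by
    rintro rfl
    have hdvd : Polynomial.X ∣ g' := by
      rw [Polynomial.X_dvd_iff]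
      have h0 : (g'.map (algebraMap E' F)).coeff 0 = 0 := by
        rw [Polynomial.coeff_zero_eq_eval_zero]; exact hYroot
      rw [Polynomial.coeff_map] at h0
      exact (algebraMap E' F).injective (by rw [h0, map_zero])
    have hg'm : g'.Monic := (minpoly.monic hyi).map _
    have hassoc : Associated Polynomial.X g' := Polynomial.irreducible_X.associated_of_dvd hg'irr hdvd
    have heq : g' = Polynomial.X :=
      (Polynomial.eq_of_monic_of_associated Polynomial.monic_X hg'm hassoc).symm
    have hgX : g = Polynomial.X := by
      apply Polynomial.map_injective θ.toRingHom θ.toRingHom.injective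
      rw [← hg', heq, Polynomial.map_X]
    have := minpoly.aeval E y
    rw [← hg, hgX, Polynomial.aeval_X] at this
    exact exp_ne_zero d this
  obtain ⟨d', hd'Y⟩ := hsurj Y hY0
  have hYalg : IsAlgebraic E' Y := ⟨g', hg'irr.ne_zero, hYg'⟩
  have hd'acl : exp d' ∈ acl (gens (K₂ ⊔ Submodule.span ℚ (range c'))) := by
    rw [hd'Y, ← acl_coe_adjoinField_eq K₂ c']
    exact mem_acl_coe_of_isAlgebraic E' hYalg
  have hd'X : d' ∉ K₂ ⊔ Submodule.span ℚ (range c') := by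
    intro hd'X
    have hYE : Y ∈ E' := by rw [← hd'Y]; exact exp_mem_adjoinField_of_mem hd'X
    have hroot : g'.IsRoot ⟨Y, hYE⟩ := by
      have h1 : algebraMap E' F (Polynomial.aeval (⟨Y, hYE⟩ : E') g') = 0 := by
        rw [← Polynomial.aeval_algebraMap_apply F (⟨Y, hYE⟩ : E') g']; exact hYg'
      have h2 : Polynomial.aeval (⟨Y, hYE⟩ : E') g' = 0 :=
        (algebraMap E' F).injective (by rw [h1, map_zero])
      rwa [Polynomial.coe_aeval_eq_eval] at h2
    have hdeg1 : g'.degree = 1 := Polynomial.degree_eq_one_of_irreducible_of_root hg'irr hroot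
    have hdegg : g.degree = 1 := by rw [hg', Polynomial.degree_map] at hdeg1; exact hdeg1
    obtain ⟨e, he⟩ := minpoly.mem_range_of_degree_eq_one E y hdegg
    have hye : y = (e : F) := he.symm
    have hge : g = Polynomial.X - Polynomial.C e := by
      rw [hg, hye]; exact minpoly.eq_X_sub_C (B := F) e
    have hYe : Y = (θ e : F) := by
      have := hYg'
      rw [hg', hge, Polynomial.map_sub, Polynomial.map_X, Polynomial.map_C, map_sub, Polynomial.aeval_X,
        Polynomial.aeval_C, sub_eq_zero] at this
      exact this
    have hsymm : h.fieldEquiv.symm ⟨Y, hYE⟩ = e := by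
      apply h.fieldEquiv.injective
      rw [RingEquiv.apply_symm_apply]
      exact Subtype.ext hYe
    have hexp : (h.fieldEquiv.symm ⟨exp d', exp_mem_adjoinField_of_mem hd'X⟩ : F) =
        exp (h.symm.transport d') := by
      rw [h.coe_fieldEquiv_symm_eq]
      exact h.symm.coe_fieldEquiv_exp hσ.symm hd'X _
    have hYeq : (⟨Y, hYE⟩ : E') = ⟨exp d', exp_mem_adjoinField_of_mem hd'X⟩ := Subtype.ext hd'Y.symm
    rw [hYeq] at hsymm
    rw [hsymm] at hexp
    have ha : h.symm.transport d' ∈ K₁ ⊔ Submodule.span ℚ (range c) := h.symm.transport_mem hσ.symm hd'X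
    have hsub : d - h.symm.transport d' ∈ K₁ := hK.sub_mem_of_exp_eq (by rw [← hy, hye, hexp])
    have : d = (d - h.symm.transport d') + h.symm.transport d' := by abel
    rw [this] at hdX
    exact hdX (Submodule.add_mem _ (Submodule.mem_sup_left hsub) ha)
  refine ⟨d', hd'acl, hd'X, h.append_single_of_indepModPowers hK hyi (by rw [hd'Y]; exact hY) ?_ ?_ hind⟩
  · exact not_mem_acl_of_exp_mem_acl hs hdacl hdX
  · exact not_mem_acl_of_exp_mem_acl hs' hd'acl hd'X

/-- **The logarithmic step over `σ`** (twisted form of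
`IsGammaIso.exists_append_single_of_exp_mem_acl`; Bays–Kirby 2018, §4.4, proof of Thm 4.17 with
Prop. 3.22). Let `K₁` be Γ-closed in the algebraically closed `F` with `exp` onto `Fˣ`,
`c ↦ c'` a Γ-isomorphism over `σ` with `c` linearly independent over `K₁`, `K₁ + ℚc ◁ F`,
`K₂ + ℚc' ◁ F`, and `d ∉ K₁ + ℚc` with `exp d` algebraic over `⟨K₁ c⟩`. Then there is
`d' ∉ K₂ + ℚc'` with `exp d'` algebraic over `⟨K₂ c'⟩` and `(c, d) ↦ (c', d')` a Γ-isomorphism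
over `σ`. [cite: BaysKirby2018ANT, §4.4 (Thm 4.17, proof), Prop. 3.22, Lemma 8.3 (proof)] -/
theorem IsGammaIsoTw.exists_append_single_of_exp_mem_acl [IsAlgClosed F]
    (hK : IsGammaClosed K₁) (hsurj : IsSurjectiveOntoUnits F) {c c' : Fin N → F}
    (h : IsGammaIsoTw σ c c') (hσ : IsEBaseIso K₁ K₂ σ) (hc : LinIndepOver K₁ c)
    (hs : IsStrong (K₁ ⊔ Submodule.span ℚ (range c)))
    (hs' : IsStrong (K₂ ⊔ Submodule.span ℚ (range c'))) {d : F}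
    (hdacl : exp d ∈ acl (gens (K₁ ⊔ Submodule.span ℚ (range c))))
    (hdX : d ∉ K₁ ⊔ Submodule.span ℚ (range c)) :
    ∃ d' : F, exp d' ∈ acl (gens (K₂ ⊔ Submodule.span ℚ (range c'))) ∧
      d' ∉ K₂ ⊔ Submodule.span ℚ (range c') ∧
      IsGammaIsoTw σ (Fin.append c ![d]) (Fin.append c' ![d']) := by
  classical
  have hind : LinIndepOver K₁ (Fin.append c ![d]) := hc.append_single hdX
  obtain ⟨ct, et, hct, hcint, het, hint, -, hindep⟩ := exists_normalised_basis hK c ![d] hind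
  set d₁ := et 0 with hd₁
  have het1 : et = ![d₁] := by
    funext i; rw [Fin.fin_one_eq_zero i]; rfl
  rw [het1] at het hint hindep
  have hct_mem : ∀ i, ct i ∈ K₁ ⊔ Submodule.span ℚ (range c) := fun i => Submodule.mem_sup_right (hct i)
  have hXt : K₁ ⊔ Submodule.span ℚ (range ct) = K₁ ⊔ Submodule.span ℚ (range c) := by
    apply le_antisymm
    · exact sup_le le_sup_left (Submodule.span_le.2 (by rintro _ ⟨i, rfl⟩; exact hct_mem i))
    · refine sup_le le_sup_left (Submodule.span_le.2 ?_)
      rintro _ ⟨i, rfl⟩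
      obtain ⟨z, hz⟩ := hcint i
      rw [SetLike.mem_coe, hz]
      exact Submodule.sum_mem _ fun l _ =>
        Submodule.smul_mem _ _ (Submodule.mem_sup_right (Submodule.subset_span ⟨l, rfl⟩))
  have hcX : ∀ i, c i ∈ K₁ ⊔ Submodule.span ℚ (range ct) := fun i => by
    rw [hXt]; exact Submodule.mem_sup_right (Submodule.subset_span ⟨i, rfl⟩)
  have hBt : K₁ ⊔ Submodule.span ℚ (range (Fin.append ct ![d₁])) =
      K₁ ⊔ Submodule.span ℚ (range (Fin.append c ![d])) := by
    apply le_antisymm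
    · refine sup_le le_sup_left (Submodule.span_le.2 ?_)
      rintro _ ⟨r, rfl⟩
      refine Fin.addCases (fun i => ?_) (fun j => ?_) r
      · rw [SetLike.mem_coe, Fin.append_left, sup_span_range_append_single]
        exact Submodule.mem_sup_left (hct_mem i)
      · rw [SetLike.mem_coe, Fin.append_right]
        exact Submodule.mem_sup_right (het j)
    · refine sup_le le_sup_left (Submodule.span_le.2 ?_)
      rintro _ ⟨s, rfl⟩
      obtain ⟨z, hz⟩ := hint s
      rw [SetLike.mem_coe, hz]
      exact Submodule.sum_mem _ fun r _ =>
        Submodule.smul_mem _ _ (Submodule.mem_sup_right (Submodule.subset_span ⟨r, rfl⟩))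
  have ht : IsGammaIsoTw σ ct (fun i => h.transport (ct i)) := h.transfer hσ hct_mem
  have hX't : K₂ ⊔ Submodule.span ℚ (range fun i => h.transport (ct i)) =
      K₂ ⊔ Submodule.span ℚ (range c') := h.sup_span_transport_eq hσ hct_mem hcX
  have hst : IsStrong (K₁ ⊔ Submodule.span ℚ (range ct)) := by rw [hXt]; exact hs
  have hst' : IsStrong (K₂ ⊔ Submodule.span ℚ (range fun i => h.transport (ct i))) := by
    rw [hX't]; exact hs'
  have hdB : d ∈ K₁ ⊔ Submodule.span ℚ (range (Fin.append ct ![d₁])) := by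
    rw [hBt]
    have := append_single_mem_sup_span (K := K₁) c d (Fin.natAdd N 0)
    simpa [Fin.append_right] using this
  have hd₁X : d₁ ∉ K₁ ⊔ Submodule.span ℚ (range ct) := by
    intro hd₁X
    have hBle : K₁ ⊔ Submodule.span ℚ (range (Fin.append ct ![d₁])) ≤ K₁ ⊔ Submodule.span ℚ (range ct) := by
      rw [sup_span_range_append_single]
      exact sup_le le_rfl ((Submodule.span_singleton_le_iff_mem _ _).2 hd₁X)
    rw [hXt] at hBle
    exact hdX (hBle hdB)
  have hd₁acl : exp d₁ ∈ acl (gens (K₁ ⊔ Submodule.span ℚ (range ct))) := by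
    rw [hXt]
    obtain ⟨q, hq⟩ := (Submodule.mem_span_range_iff_exists_fun ℚ).1 (het 0)
    have hsplit : d₁ = (∑ i : Fin N, q (Fin.castAdd 1 i) • c i) + q (Fin.natAdd N 0) • d := by
      have h0 : (![d₁] : Fin 1 → F) 0 = d₁ := rfl
      rw [← h0, ← hq, Fin.sum_univ_add]
      simp [Fin.append_left, Fin.append_right]
    rw [hsplit, exp_add]
    refine mul_mem_acl ?_ (exp_smul_mem_acl _ hdacl)
    refine subset_acl _ (exp_mem_gens (Submodule.mem_sup_right ?_))
    exact Submodule.sum_mem _ fun i _ => Submodule.smul_mem _ _ (Submodule.subset_span ⟨i, rfl⟩)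
  obtain ⟨D₁, hD₁acl, hD₁X, h₁⟩ :=
    ht.exists_append_single_of_exp_mem_acl_of_indepModPowers hK hsurj hσ hst hst' hd₁acl hd₁X hindep
  have hy : ∀ j, Fin.append c ![d] j ∈ K₁ ⊔ Submodule.span ℚ (range (Fin.append ct ![d₁])) := by
    intro j; rw [hBt]; exact append_single_mem_sup_span c d j
  have h₂ := h₁.transfer hσ hy
  have hct_memB : ∀ i, ct i ∈ K₁ ⊔ Submodule.span ℚ (range (Fin.append ct ![d₁])) := fun i => by
    have := append_single_mem_sup_span (K := K₁) ct d₁ (Fin.castAdd 1 i)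
    rwa [Fin.append_left] at this
  have hagree : ∀ z ∈ K₁ ⊔ Submodule.span ℚ (range c), h₁.transport z = h.transport z := by
    intro z hz
    rw [← hXt] at hz
    have e1 : ht.transport z = h₁.transport z :=
      ht.transport_eq_transport h₁ hct_memB (fun i => by
        have := h₁.transport_apply (Fin.castAdd 1 i)
        rwa [Fin.append_left, Fin.append_left] at this) hz
    have e2 : ht.transport z = h.transport z :=
      ht.transport_eq_transport h hct_mem (fun _ => rfl) hz
    rw [← e1, e2]
  have hfun : (fun j => h₁.transport (Fin.append c ![d] j)) = Fin.append c' ![h₁.transport d] := by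
    funext j
    refine Fin.addCases (fun i => ?_) (fun i => ?_) j
    · rw [Fin.append_left, Fin.append_left,
        hagree _ (Submodule.mem_sup_right (Submodule.subset_span ⟨i, rfl⟩)), h.transport_apply]
    · rw [Fin.append_right, Fin.append_right, Fin.fin_one_eq_zero i]; rfl
  rw [hfun] at h₂
  refine ⟨h₁.transport d, ?_, ?_, h₂⟩
  · have hd'mem : h₁.transport d ∈
        K₂ ⊔ Submodule.span ℚ (range (Fin.append (fun i => h.transport (ct i)) ![D₁])) :=
      h₁.transport_mem hσ hdB
    rw [sup_span_range_append_single, hX't] at hd'mem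
    obtain ⟨x₀, hx₀, w, hw, hsum⟩ := Submodule.mem_sup.1 hd'mem
    obtain ⟨q, rfl⟩ := Submodule.mem_span_singleton.1 hw
    rw [← hsum, exp_add]
    rw [hX't] at hD₁acl
    exact mul_mem_acl (subset_acl _ (exp_mem_gens hx₀)) (exp_smul_mem_acl q hD₁acl)
  · intro hd'X
    have hback : h₁.symm.transport (h₁.transport d) = d := h₁.transport_symm_transport hσ hdB
    have hct'_memB : ∀ i, h.transport (ct i) ∈
        K₂ ⊔ Submodule.span ℚ (range (Fin.append (fun i => h.transport (ct i)) ![D₁])) := fun i => by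
      have := append_single_mem_sup_span (K := K₂) (fun i => h.transport (ct i)) D₁ (Fin.castAdd 1 i)
      rwa [Fin.append_left] at this
    have hct'_mem : ∀ i, h.transport (ct i) ∈ K₂ ⊔ Submodule.span ℚ (range c') := fun i =>
      h.transport_mem hσ (hct_mem i)
    have hz : h₁.transport d ∈ K₂ ⊔ Submodule.span ℚ (range fun i => h.transport (ct i)) := by
      rw [hX't]; exact hd'X
    have e1 : ht.symm.transport (h₁.transport d) = h₁.symm.transport (h₁.transport d) :=
      ht.symm.transport_eq_transport h₁.symm hct'_memB (fun i => by
        have := h₁.symm.transport_apply (Fin.castAdd 1 i)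
        rwa [Fin.append_left, Fin.append_left] at this) hz
    have e2 : ht.symm.transport (h₁.transport d) = h.symm.transport (h₁.transport d) :=
      ht.symm.transport_eq_transport h.symm hct'_mem
        (fun i => h.transport_symm_transport hσ (hct_mem i)) hz
    have hmem : h.symm.transport (h₁.transport d) ∈ K₁ ⊔ Submodule.span ℚ (range c) :=
      h.symm.transport_mem hσ.symm hd'X
    rw [← e2, e1, hback] at hmem
    exact hdX hmem

end LogStep

end GammaField

end Literature.NumberTheory.Transcendental
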